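import Summits.BirchSwinnertonDyer.BirchSwinnertonDyer.Theorems.SignedLowerHalvesSmallImageLowerHalfBothSignsLambdaLowerThreeNsThetaPartnerEmbeddings
import Summits.BirchSwinnertonDyer.BirchSwinnertonDyer.Theorems.SignedLowerHalvesSmallImageLowerHalfBothSignsLambdaLowerThreeNsThetaPartnerIdelic
import Summits.BirchSwinnertonDyer.BirchSwinnertonDyer.Theorems.ResidualThetaTransportAtTwoHeckeThetaPartnerAdicAtTwoTeichmullerTwistPrelim
import Summits.BirchSwinnertonDyer.BirchSwinnertonDyer.Theorems.ResidualThetaTransportAtTwoHeckeThetaPartnerAdicAtTwoMatchingAtTwoPrelim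
import Literature.NumberTheory.GaloisRepresentations.GaloisRepUnramifiedProofs
import Literature.NumberTheory.GaloisRepresentations.InertiaRootsOfUnity
import Literature.NumberTheory.GaloisRepresentations.LocalArtinMapPinned
import Literature.NumberTheory.GaloisRepresentations.CalegariEvenFontaineMazurTwo
import HarnessLib

/-!
# The matching condition of the Teichmüller twist at the inert prime: one of `σ, σ̄` matches
# (brick S7 of the odd-`p` Hecke theta partner)

Route `SignedLowerHalves`, child L `SmallImageLowerHalfBothSigns` (item stmt-BirchSwinnertonDyer-23599), line
proposal `rtt_w3`, stub K0₂@p `stub_heckeThetaPartner_ns` — brick S7 of the arithmetic half at an ODD prime (width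
seat `bsd-line-slh-p3-w3` gen 9; memo `Lines/birth_acns-MEMO-w3-g9.md`).  THEOREMS ONLY (no definition, no named
fact, no `sorry`); ROUTE-INDEPENDENT.

Setting: `K` a quadratic number field, `p` a prime INERT in `K` (`v.asIdeal = p𝓞_K`, `p` a uniformiser of `K_v`),
`c : K →+* K` an endomorphism acting as Frobenius modulo `v` (`c b ≡ b^p`: the non-trivial automorphism),
a residue embedding `ι : 𝓀(\bar K_v) → k̄_p`, `e : ℚ̄_p ≃ ℂ`, `σ : K → ℂ`.

* §1 `exists_ringHom_residue_local` — the ring homomorphism `R = ι ∘ (b ↦ b mod 𝔓_v) : 𝓞 K → k̄_p` (through the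
  completion), with `R b = ι(residue_{K_v}(b))`, `R(v) = 0` and `(R b)^{p²−1} = 1` for `b ∉ v`.
* §2 `exists_ringHom_residue_embedding` — the ring homomorphism `G_σ = (b ↦ e⁻¹σ(b) mod 𝔪) : 𝓞 K → k̄_p`, `G_σ(v) = 0`.
* §3 **`exists_embedding_residue_eq`** — there is `σ' ∈ {σ, σ ∘ c}` with `G_{σ'} = R`: both factor through the
  field `𝓞 K / v` of `p²` elements, two such embeddings differ by a power of Frobenius (brick S7a
  `ringHom_eq_or_eq_frobenius_of_card_eq_sq`), and composing `σ` with `c` composes `G_σ` with Frobenius.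
* §4 **`norm_idealPow_sub_embedding_lt_one`** — the MATCHING CONDITION `hM` of
  `…TeichmullerTwist.exists_isGrossencharakter_congr`: for a finite-order Hecke character `η` of `K` with module
  `(T, e)`, `v ∈ T`, whose local component at `v` is `u ↦ e(Teich(ι ū))⁻¹` on `𝒪_vˣ` (brick ORIENT-CFT
  `exists_heckeCharacter_localComponent_eq`), and `σ'` as in §3: for every `b ≠ 0`, `b ∉ v`,
  `b ≡ 1 mod 𝔭_w^{e_w+1}` (`w ∈ T ∖ {v}`): `‖e⁻¹(η̃((b))) − e⁻¹(σ'(b))‖ < 1`, `η̃((b)) = ∏ η(ϖ_𝔮)^{ord_𝔮 b}`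
  (brick S6 `idealPow_valueAtUniformizer_span_eq_inv`: `= η_v(b)⁻¹ = e(Teich(ι b̄))`, whose residue is
  `ι(b̄) = R b = G_{σ'} b`, the residue of `e⁻¹σ'(b)`).

BSD, crux L and the stub are NOT proved here.

References: J. Neukirch, ANT VII §6; J.-P. Serre, *Local Fields* II §4 Prop. 8; folklore (finite fields).
-/

set_option autoImplicit false
set_option linter.dupNamespace false

noncomputable section

open NumberField IsDedekindDomain IsDedekindDomain.HeightOneSpectrum Field
open scoped nonZeroDivisors

namespace Summit.BirchSwinnertonDyer.BirchSwinnertonDyer.Theorems.SmallImageLambdaLowerThreeNsThetaPartner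

open Literature.NumberTheory.GaloisRepresentations Literature.NumberTheory.GaloisRepresentations.HeckeCharacter
  Literature.NumberTheory.GaloisRepresentations.IsNonarchimedeanLocalField Literature.NumberTheory
  Summit.BirchSwinnertonDyer.BirchSwinnertonDyer.Theorems.HeckeThetaPartner ValuativeRel

variable {K : Type} [Field K] [NumberField K] {p : ℕ} [Fact p.Prime]

/-! ### §1. Reduction modulo the inert prime, read in `k̄_p` through the completion -/

/-- **The local residue homomorphism.**  For a place `v` of `K` at which `p` is a uniformiser of `K_v` and
`v = p𝓞_K`, and a residue embedding `ι : 𝓀(\bar K_v) → k̄_p`: the map `R : 𝓞 K → k̄_p`,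
`R b = ι(residue_{K_v}(b))` (reduction of the image of `b` in `\bar K_v`), is a ring homomorphism vanishing on
`v`, and `(R b)^{p²−1} = 1` for `b ∉ v` when `#(𝓞 K/v) = p²`. [folklore] -/
theorem exists_ringHom_residue_local (v : HeightOneSpectrum (𝓞 K)) (hvp : v.asIdeal = Ideal.span {(p : 𝓞 K)})
    (hπ : (valuation (v.adicCompletion K)).IsUniformizer ((p : ℕ) : v.adicCompletion K))
    (hcard : Nat.card (𝓞 K ⧸ v.asIdeal) = p ^ 2)
    (ι : absIntegers 𝒪[v.adicCompletion K] (v.adicCompletion K) ⧸ absMaximalIdeal (v.adicCompletion K) →+*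
      padicAlgClResidueField p) :
    ∃ R : 𝓞 K →+* padicAlgClResidueField p,
      (∀ b : 𝓞 K, R b = ι (residue (v.adicCompletion K)
        (algebraMap (v.adicCompletion K) (AlgebraicClosure (v.adicCompletion K))
          (algebraMap (𝓞 K) (v.adicCompletion K) b)))) ∧
      (∀ b ∈ v.asIdeal, R b = 0) ∧
      (∀ b : 𝓞 K, b ∉ v.asIdeal → R b ^ (p ^ 2 - 1) = 1) := by
  classical
  set F := v.adicCompletion K with hF
  -- integrality of the images of `𝓞 K` in `\bar K_v`
  have hmemO : ∀ b : 𝓞 K, algebraMap (𝓞 K) F b ∈ 𝒪[F] := fun b =>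
    (Valuation.mem_integer_iff _ _).mpr
      ((adicCompletion_valuation_le_one_iff K v _).mpr (norm_algebraMap_ringOfIntegers_le_one K v b))
  have hnorm : ∀ b : 𝓞 K, algNorm F (algebraMap F (AlgebraicClosure F) (algebraMap (𝓞 K) F b)) ≤ 1 := fun b =>
    algNorm_algebraMap_le_one_iff.mpr (hmemO b)
  have hmem : ∀ b : 𝓞 K, algebraMap F (AlgebraicClosure F) (algebraMap (𝓞 K) F b) ∈ absIntegers 𝒪[F] F :=
    fun b => mem_absIntegers_iff_algNorm_le_one.mpr (hnorm b)
  -- the ring homomorphism `𝓞 K → \bar ℤ_{K_v} → \bar ℤ_{K_v}/𝔓 → k̄_p`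
  let f : 𝓞 K →+* absIntegers 𝒪[F] F :=
    ((algebraMap F (AlgebraicClosure F)).comp (algebraMap (𝓞 K) F)).codRestrict (absIntegers 𝒪[F] F).toSubring
      fun b => hmem b
  let R : 𝓞 K →+* padicAlgClResidueField p := ι.comp ((Ideal.Quotient.mk (absMaximalIdeal F)).comp f)
  have hR : ∀ b : 𝓞 K, R b = ι (residue F (algebraMap F (AlgebraicClosure F) (algebraMap (𝓞 K) F b))) := by
    intro b
    change ι (Ideal.Quotient.mk (absMaximalIdeal F) (f b)) = _
    rw [residue_of_le (hnorm b)]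
    rfl
  -- `R` kills `v = (p)`
  have hRp : R (p : 𝓞 K) = 0 := by
    rw [hR, map_natCast]
    have hlt : algNorm F (algebraMap F (AlgebraicClosure F) ((p : ℕ) : F)) < 1 :=
      algNorm_algebraMap_lt_one_iff.mpr hπ.val_lt_one
    rw [(residue_eq_zero_iff hlt.le).mpr hlt, map_zero]
  have hRv : ∀ b ∈ v.asIdeal, R b = 0 := by
    intro b hb
    rw [hvp, Ideal.mem_span_singleton] at hb
    obtain ⟨c, rfl⟩ := hb
    rw [map_mul, hRp, zero_mul]
  refine ⟨R, hR, hRv, fun b hb => ?_⟩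
  -- `(R b)^{p²−1} = 1` off `v`: through the field `𝓞 K / v` of `p²` elements
  haveI : v.asIdeal.IsMaximal := v.isMaximal
  letI : Field (𝓞 K ⧸ v.asIdeal) := Ideal.Quotient.field v.asIdeal
  haveI : Finite (𝓞 K ⧸ v.asIdeal) := Ideal.finiteQuotientOfFreeOfNeBot v.asIdeal v.ne_bot
  letI : Fintype (𝓞 K ⧸ v.asIdeal) := Fintype.ofFinite _
  have hcard' : Fintype.card (𝓞 K ⧸ v.asIdeal) = p ^ 2 := by rw [← Nat.card_eq_fintype_card, hcard]
  have hker : ∀ a ∈ v.asIdeal, R a = 0 := hRv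
  let Rbar : 𝓞 K ⧸ v.asIdeal →+* padicAlgClResidueField p := Ideal.Quotient.lift v.asIdeal R hker
  have hb0 : (Ideal.Quotient.mk v.asIdeal b) ≠ 0 := by
    rw [Ne, Ideal.Quotient.eq_zero_iff_mem]; exact hb
  have h1 : (Ideal.Quotient.mk v.asIdeal b) ^ (p ^ 2 - 1) = 1 := by
    rw [← hcard']; exact FiniteField.pow_card_sub_one_eq_one _ hb0
  have h2 := congrArg Rbar h1
  rw [map_pow, map_one] at h2
  simpa [Rbar, Ideal.Quotient.lift_mk] using h2

/-! ### §2. The `e`-adic residue of an embedding -/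

omit [NumberField K] in
/-- **The residue of `e⁻¹ ∘ σ` on `𝓞 K`.**  For `σ : K → ℂ` and `e : ℚ̄_p ≃ ℂ`, `b ↦ (e⁻¹σ(b)) mod 𝔪` is a ring
homomorphism `𝓞 K → k̄_p` (algebraic integers are `e`-adically integral, `norm_symm_embedding_le_one`); it
vanishes on the ideal `p𝓞_K`. [folklore] -/
theorem exists_ringHom_residue_embedding (e : PadicAlgCl p ≃+* ℂ) (σ : K →+* ℂ) :
    ∃ G : 𝓞 K →+* padicAlgClResidueField p,
      (∀ b : 𝓞 K, G b = IsLocalRing.residue (padicAlgClIntegers p)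
        ⟨e.symm (σ (b : K)), (padicAlgCl_mem_valuationSubring_iff p _).mpr (norm_symm_embedding_le_one e σ b)⟩) ∧
      (∀ b ∈ Ideal.span {(p : 𝓞 K)}, G b = 0) := by
  let g : 𝓞 K →+* padicAlgClIntegers p :=
    (((e.symm : ℂ ≃+* PadicAlgCl p) : ℂ →+* PadicAlgCl p).comp (σ.comp (algebraMap (𝓞 K) K))).codRestrict
      (padicAlgClIntegers p).toSubring
      fun b => (padicAlgCl_mem_valuationSubring_iff p _).mpr (norm_symm_embedding_le_one e σ b)
  let G : 𝓞 K →+* padicAlgClResidueField p := (IsLocalRing.residue (padicAlgClIntegers p)).comp g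
  refine ⟨G, fun b => rfl, fun b hb => ?_⟩
  rw [Ideal.mem_span_singleton] at hb
  obtain ⟨c, rfl⟩ := hb
  haveI : CharP (padicAlgClResidueField p) p := charP_padicAlgClResidueField p
  rw [map_mul, map_natCast, CharP.cast_eq_zero, zero_mul]

/-! ### §3. One of `σ, σ ∘ c` matches -/

/-- **One of the two embeddings matches the local residue map.**  With `R` the local residue homomorphism of
§1 and `G_σ` the `e`-adic residue of §2: if `c : K →+* K` acts as Frobenius on `𝓞 K` modulo `v = p𝓞_K`
(`c b − b^p ∈ v`, with `c(𝓞 K) ⊆ 𝓞 K`), then `G_{σ'} = R` for `σ' = σ` or `σ' = σ ∘ c`.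
[folklore] -/
theorem exists_embedding_residue_eq (v : HeightOneSpectrum (𝓞 K)) (hvp : v.asIdeal = Ideal.span {(p : 𝓞 K)})
    (hcard : Nat.card (𝓞 K ⧸ v.asIdeal) = p ^ 2)
    (c : K →+* K) (cO : 𝓞 K →+* 𝓞 K) (hcO : ∀ b : 𝓞 K, ((cO b : 𝓞 K) : K) = c (b : K))
    (hc : ∀ b : 𝓞 K, cO b - b ^ p ∈ v.asIdeal)
    (e : PadicAlgCl p ≃+* ℂ) (σ : K →+* ℂ)
    (R : 𝓞 K →+* padicAlgClResidueField p) (hRv : ∀ b ∈ v.asIdeal, R b = 0) :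
    ∃ σ' : K →+* ℂ, (σ' = σ ∨ σ' = σ.comp c) ∧
      ∀ (G : 𝓞 K →+* padicAlgClResidueField p),
        (∀ b : 𝓞 K, G b = IsLocalRing.residue (padicAlgClIntegers p)
          ⟨e.symm (σ' (b : K)), (padicAlgCl_mem_valuationSubring_iff p _).mpr (norm_symm_embedding_le_one e σ' b)⟩) →
        ∀ b : 𝓞 K, G b = R b := by
  classical
  haveI : v.asIdeal.IsMaximal := v.isMaximal
  letI : Field (𝓞 K ⧸ v.asIdeal) := Ideal.Quotient.field v.asIdeal
  haveI : Finite (𝓞 K ⧸ v.asIdeal) := Ideal.finiteQuotientOfFreeOfNeBot v.asIdeal v.ne_bot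
  letI : Fintype (𝓞 K ⧸ v.asIdeal) := Fintype.ofFinite _
  have hcard' : Fintype.card (𝓞 K ⧸ v.asIdeal) = p ^ 2 := by rw [← Nat.card_eq_fintype_card, hcard]
  -- the residue of `e⁻¹ ∘ σ`
  obtain ⟨Gσ, hGσ, hGσv⟩ := exists_ringHom_residue_embedding (K := K) e σ
  have hGσv' : ∀ b ∈ v.asIdeal, Gσ b = 0 := by rw [hvp]; exact hGσv
  -- both descend to the residue field `𝓞 K / v`
  let Rb : 𝓞 K ⧸ v.asIdeal →+* padicAlgClResidueField p := Ideal.Quotient.lift v.asIdeal R hRv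
  let Gb : 𝓞 K ⧸ v.asIdeal →+* padicAlgClResidueField p := Ideal.Quotient.lift v.asIdeal Gσ hGσv'
  have hRb : ∀ b, Rb (Ideal.Quotient.mk v.asIdeal b) = R b := fun b => Ideal.Quotient.lift_mk _ _ _
  have hGb : ∀ b, Gb (Ideal.Quotient.mk v.asIdeal b) = Gσ b := fun b => Ideal.Quotient.lift_mk _ _ _
  -- uniqueness of the residue of `e⁻¹ ∘ σ'` as a function (any `G` with the displayed values IS it)
  have huniqσ : ∀ (G : 𝓞 K →+* padicAlgClResidueField p),
      (∀ b : 𝓞 K, G b = IsLocalRing.residue (padicAlgClIntegers p)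
        ⟨e.symm (σ (b : K)), (padicAlgCl_mem_valuationSubring_iff p _).mpr (norm_symm_embedding_le_one e σ b)⟩) →
      ∀ b, G b = Gσ b := fun G hG b => by rw [hG, hGσ]
  rcases ringHom_eq_or_eq_frobenius_of_card_eq_sq (p := p) hcard' Rb Gb with h | h
  · -- `σ` itself matches
    refine ⟨σ, Or.inl rfl, fun G hG b => ?_⟩
    rw [huniqσ G hG b, ← hGb, h, hRb]
  · -- `σ ∘ c` matches: `G_{σ∘c}(b) = G_σ(c b) = G_σ(b^p) = R(b)^{p²} = R b`
    refine ⟨σ.comp c, Or.inr rfl, fun G hG b => ?_⟩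
    have hG' : G b = Gσ (cO b) := by
      rw [hG, hGσ]
      congr 1
      apply Subtype.ext
      simp only [RingHom.coe_comp, Function.comp_apply, hcO]
    have hcb : Gσ (cO b) = Gσ (b ^ p) := by
      have h0 : Gσ (cO b - b ^ p) = 0 := hGσv' _ (hc b)
      rwa [map_sub, sub_eq_zero] at h0
    calc G b = Gσ (cO b) := hG'
      _ = Gσ (b ^ p) := hcb
      _ = Gb (Ideal.Quotient.mk v.asIdeal (b ^ p)) := (hGb _).symm
      _ = Rb (Ideal.Quotient.mk v.asIdeal (b ^ p)) ^ p := h _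
      _ = Rb ((Ideal.Quotient.mk v.asIdeal b) ^ (p ^ 2)) := by rw [map_pow, ← map_pow, ← pow_mul, ← sq]
      _ = Rb (Ideal.Quotient.mk v.asIdeal b) := by rw [← hcard', FiniteField.pow_card]
      _ = R b := hRb b

/-! ### §4. The matching condition of the Teichmüller twist -/

/-- **The matching condition `hM` at the inert prime.**  Let `K` be totally complex, `η` a finite-order Hecke
character of `K` with module of definition `(T, eT)`, `v ∈ T` a place with `v = p𝓞_K`, `p` a uniformiser of
`K_v` and `#(𝓞 K/v) = p²`, `ι` a residue embedding, `e : ℚ̄_p ≃ ℂ`, `Tz` a Teichmüller section of exponent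
`p² − 1`, and suppose the local component of `η` at `v` is `(η_v(a w))⁻¹ = e(Tz(ι(a(w) mod 𝔓)))` on the Weil
inertia (brick ORIENT-CFT).  Let `σ' : K → ℂ` be an embedding whose `e`-adic residue matches the local residue
map (§3).  Then for every `b ∈ 𝓞 K`, `b ≠ 0`, `b ∉ v`, `b ≡ 1 mod 𝔭_w^{eT_w+1}` for `w ∈ T ∖ {v}`:
`‖e⁻¹(∏_𝔮 η(ϖ_𝔮)^{ord_𝔮 b}) − e⁻¹(σ'(b))‖ < 1`. [cite: NeukirchANT1999, Ch. VII §6 Prop. (6.13) (proof)]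
[cite: SerreLocalFields1979, Ch. II §4 Prop. 8] -/
theorem norm_idealPow_sub_embedding_lt_one [IsTotallyComplex K] (v : HeightOneSpectrum (𝓞 K))
    (hvp : v.asIdeal = Ideal.span {(p : 𝓞 K)})
    (hπ : (valuation (v.adicCompletion K)).IsUniformizer ((p : ℕ) : v.adicCompletion K))
    (hcard : Nat.card (𝓞 K ⧸ v.asIdeal) = p ^ 2)
    (ι : absIntegers 𝒪[v.adicCompletion K] (v.adicCompletion K) ⧸ absMaximalIdeal (v.adicCompletion K) →+*
      padicAlgClResidueField p)
    (e : PadicAlgCl p ≃+* ℂ) (σ' : K →+* ℂ)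
    (hσ' : ∀ b : 𝓞 K, IsLocalRing.residue (padicAlgClIntegers p)
        ⟨e.symm (σ' (b : K)), (padicAlgCl_mem_valuationSubring_iff p _).mpr (norm_symm_embedding_le_one e σ' b)⟩ =
      ι (residue (v.adicCompletion K)
        (algebraMap (v.adicCompletion K) (AlgebraicClosure (v.adicCompletion K))
          (algebraMap (𝓞 K) (v.adicCompletion K) b))))
    (Tz : padicAlgClResidueField p → padicAlgClIntegers p)
    (hTz : ∀ z, z ^ (p ^ 2 - 1) = 1 →
      (Tz z : PadicAlgCl p) ^ (p ^ 2 - 1) = 1 ∧ IsLocalRing.residue (padicAlgClIntegers p) (Tz z) = z)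
    {η : HeckeCharacter K} (hfin : η.IsFiniteOrder) {T : Finset (HeightOneSpectrum (𝓞 K))}
    {eT : HeightOneSpectrum (𝓞 K) → ℕ} (hmod : IsModulus η T eT) (hvT : v ∈ T)
    (hloc : ∀ (a : WeilGroup (v.adicCompletion K) →* (v.adicCompletion K)ˣ), IsLocalArtinMap (v.adicCompletion K) a →
      ∀ w : WeilGroup (v.adicCompletion K), w ∈ WeilGroup.inertia (v.adicCompletion K) →
        (((η.localComponent v (a w))⁻¹ : ℂˣ) : ℂ) =
          e (Tz (ι (residue (v.adicCompletion K)
            (algebraMap (v.adicCompletion K) (AlgebraicClosure (v.adicCompletion K)) (a w : v.adicCompletion K))))))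
    {b : 𝓞 K} (hb : b ≠ 0) (hbv : b ∉ v.asIdeal) (hbT : ∀ w ∈ T, w ≠ v → b - 1 ∈ w.asIdeal ^ (eT w + 1)) :
    ‖e.symm (LFunctions.idealPow K (fun w => η.valueAtUniformizer w) (Ideal.span {b})) - e.symm (σ' (b : K))‖ < 1 := by
  classical
  set F := v.adicCompletion K with hF
  -- the local residue homomorphism and the value `z = ι(b̄)`, a `(p²−1)`-th root of unity
  obtain ⟨R, hR, hRv, hRpow⟩ := exists_ringHom_residue_local (K := K) v hvp hπ hcard ι
  set z := R b with hz
  have hzpow : z ^ (p ^ 2 - 1) = 1 := hRpow b hbv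
  -- S6: `η̃((b)) = η_v(b)⁻¹`
  have hb' : (b : K) ≠ 0 := fun h => hb (by exact_mod_cast h)
  rw [idealPow_valueAtUniformizer_span_eq_inv hfin hmod hvT hb hbv hbT]
  -- the unit `b ∈ 𝒪_vˣ` is `a(w)` for some `w` in the Weil inertia
  set u : Fˣ := globalToLocalUnits v (Units.mk0 (b : K) hb') with hu
  have hu1 : Valued.v (u : F) = 1 := by
    rw [hu, val_globalToLocalUnits, Units.val_mk0, valued_algebraMap_adicCompletion]
    exact (valuation_eq_one_iff_notMem (K := K) v).mpr hbv
  have ha := isLocalArtinMap_canonicalArtin_holds F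
  have hub : (u : F) = algebraMap (𝓞 K) F b := by
    rw [hu, val_globalToLocalUnits, Units.val_mk0, IsScalarTower.algebraMap_apply (𝓞 K) K F]
  have hnorm_le : ‖(u : F)‖ ≤ 1 := by rw [hub]; exact norm_algebraMap_ringOfIntegers_le_one K v b
  have hnorm_nlt : ¬ ‖(u : F)‖ < 1 := by
    rw [Valued.toNormedField.norm_lt_one_iff, hu1]; exact lt_irrefl _
  have humem : u ∈ (valuation F).valuationSubring.unitGroup := by
    rw [Valuation.mem_unitGroup_iff]
    refine le_antisymm ((adicCompletion_valuation_le_one_iff K v _).mpr hnorm_le) ?_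
    by_contra hlt
    exact hnorm_nlt ((adicCompletion_valuation_lt_one_iff K v _).mp (not_le.mp hlt))
  obtain ⟨w, hwI, hw⟩ : ∃ w ∈ WeilGroup.inertia F, canonicalArtin F w = u := by
    have h := humem
    rw [← ha.image_inertia] at h
    exact Subgroup.mem_map.mp h
  have hval := hloc (canonicalArtin F) ha w hwI
  rw [hw, localComponent_apply, hub] at hval
  -- `hval : η_v(b)⁻¹ = e (Tz z)`
  have hz' : ι (residue F (algebraMap F (AlgebraicClosure F) (algebraMap (𝓞 K) F b))) = z := by rw [hz, hR]
  rw [hz'] at hval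
  rw [hval, RingEquiv.symm_apply_apply]
  -- compare residues through `e`
  obtain ⟨ρ, -, -, -, ρ_eq_iff, -, ρ_e⟩ := exists_residueMap e
  set wσ : padicAlgClIntegers p := ⟨e.symm (σ' (b : K)),
    (padicAlgCl_mem_valuationSubring_iff p _).mpr (norm_symm_embedding_le_one e σ' b)⟩ with hwσ
  have hx : ‖e.symm (e (Tz z : PadicAlgCl p))‖ ≤ 1 := by
    rw [RingEquiv.symm_apply_apply]; exact (padicAlgCl_mem_valuationSubring_iff p _).mp (Tz z).2
  have hy : ‖e.symm (σ' (b : K))‖ ≤ 1 := norm_symm_embedding_le_one e σ' b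
  have hρx : ρ (e (Tz z : PadicAlgCl p)) = z := by rw [ρ_e, (hTz z hzpow).2]
  have hρy : ρ (σ' (b : K)) = z := by
    have h1 : σ' (b : K) = e (wσ : PadicAlgCl p) := by rw [hwσ]; exact (e.apply_symm_apply _).symm
    rw [h1, ρ_e, ← hz', ← hσ' b]
  have h := (ρ_eq_iff _ _ hx hy).mp (hρx.trans hρy.symm)
  rwa [RingEquiv.symm_apply_apply] at h

end Summit.BirchSwinnertonDyer.BirchSwinnertonDyer.Theorems.SmallImageLambdaLowerThreeNsThetaPartner

end
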